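import Summits.QuantumFields.YangMills.Theorems.MirrorModularBoostsCurvatureBoostCovarianceDominatedTieLimit

/-!
# Truncated tie limit: tempered lattice densities converging on separated tensors converge on `⁰𝒮` — stub `stub_truncatedTieLimit`

Line `Sketch` (markov-shielding) of crux `IsotropyFromPowerCounting.TemperedCurvatureMoments`
(stmt-QuantumFields-17721), Stub A2 of the registered skeleton
`Cruxes/TemperedCurvatureMoments/Lines/Sketch.lean` (model-blind analysis of the mesoscopic reduction).

Statement (`stub_truncatedTieLimit`, registered signature verbatim).  On `X = (ℝ⁴)ⁿ` (`n > 0`) suppose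
the SEPARATED DENSITY: every `F ∈ ⁰𝒮(X)` (`IsOffDiagonal`) lies in the closure of the `ℂ`-span of the
real product tensors `P = ⊗ᵢ fᵢ` with compactly supported, pairwise separated factors.  Let `T` be a
continuous linear functional on `𝓢(X, ℂ)`, `a_k → 0⁺` lattice spacings and `L_k` half-sides with
`a_k L_k → ∞`, and `D_k : (ℤ⁴)ⁿ → ℝ` lattice densities tempered at the injective multi-sites of the box
for `k ≥ k₀`: `|D_k x| ≤ C (1 + ‖a_k x‖)^N (1 + Σ_i Σ_{j ≠ i} ‖a_k xᵢ - a_k xⱼ‖⁻¹)^N`.  If the lattice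
functionals `Λ_k G = (a_k⁴)ⁿ Σ_{x ∈ boxⁿ} G(a_k x) D_k x` converge to `T P` on every separated compactly
supported real product tensor `P`, then `Λ_k F → T F` for every `F ∈ ⁰𝒮`.

Proof (steps 1–3 of the landed `stub_dominatedTieLimit`, with the weight
`w y = C (1 + ‖y‖)^N (1 + Σ_i Σ_{j ≠ i} ‖yᵢ - yⱼ‖⁻¹)^N` and the smaller generator set).
1. *Majorant*: for `G ∈ ⁰𝒮`, `‖G y‖ w y ≤ K₀ q(G) (1 + ‖y‖)^{-8n}` (`DominatedTieLimit.norm_mul_weight_le`,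
   flat decay against the pair weight), `q` a finite sup of Schwartz seminorms.
2. *Equicontinuity on `⁰𝒮`*: `G` vanishes at the non-injective scaled multi-sites, so
   `‖Λ_k G‖ ≤ (a_k⁴)ⁿ Σ_x ‖G(a_k x)‖ w(a_k x)` (`DominatedTieLimit.norm_latticeSum_le`), which is
   `≤ K₀ 4^{4n} q(G)` for `k ≥ k₀` and `a_k ≤ 1` by the mesh-uniform bound
   `DominatedTieLimit.latticeSum_majorant_le`.
3. *Density + linearity*: every separated tensor is off-diagonal (its support misses the coincidence
   locus: `IsTensorOf.tsupport_subset`, `IsOffDiagonal.of_tsupport_subset`), hence so is its span; the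
   `Λ_k` (finite combinations of evaluations, as continuous linear functionals) converge on the span by
   linearity, and the `ε/3` argument `DominatedTieLimit.tendsto_of_mem_closure_span` with the
   equicontinuity bound gives `Λ_k F → T F` on the closure within `⁰𝒮`, i.e. on all of `⁰𝒮` by the
   separated density.

References: K. Osterwalder, R. Schrader, Comm. Math. Phys. 31 (1973) §2 and 42 (1975) §2 (`⁰𝒮`,
temperedness estimates for lattice approximants); J. Glimm, A. Jaffe, Quantum Physics (1987) §9.5–9.6
(lattice approximation). [folklore]
-/

noncomputable section

namespace Summit.QuantumFields.YangMills.Theorems.TemperedCurvatureMoments.Sketch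

open scoped BigOperators SchwartzMap Topology
open MeasureTheory Filter
open Literature.MathematicalPhysics.QuantumLattice Literature.MathematicalPhysics.AQFT
open Literature.Probability.LatticeModels (box mem_box Site)
open Summit.QuantumFields.YangMills.Theorems.NPointIsotropy.Negative (E4)
open Summit.QuantumFields.YangMills.Theorems.NPointIsotropy.ComplexRotationBandlimit
open Summit.QuantumFields.YangMills.Theorems.CurvatureBoostCovariance.BoostsInheritMirrors

/-- **Separated real product tensors are off-diagonal.** If `P = ⊗ᵢ fᵢ` with pairwise `r`-separated
supports (`r > 0`), then `tsupport P` misses the coincidence locus, so `P ∈ ⁰𝒮`. [folklore] -/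
theorem isOffDiagonal_of_isTensorOf_separated {n : ℕ} {P : 𝓢((Fin n → E4), ℂ)}
    {f : Fin n → 𝓢(E4, ℝ)} (hP : IsTensorOf P (fun i => ofRealTest (f i))) {r : ℝ} (hr : 0 < r)
    (hsep : ∀ i j, i ≠ j → ∀ y ∈ tsupport (f i : E4 → ℝ), ∀ z ∈ tsupport (f j : E4 → ℝ),
      r ≤ ‖y - z‖) :
    IsOffDiagonal P := by
  refine IsOffDiagonal.of_tsupport_subset fun x hx hxA => ?_
  obtain ⟨i, j, hij, hxij⟩ := hxA
  have hsub : ∀ i, tsupport (ofRealTest (f i) : E4 → ℂ) ⊆ tsupport (f i : E4 → ℝ) := fun i =>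
    tsupport_comp_subset (g := fun t : ℝ => (t : ℂ)) Complex.ofReal_zero _
  have hi : x i ∈ tsupport (f i : E4 → ℝ) := hsub i (hP.tsupport_subset hx i)
  have hj : x j ∈ tsupport (f j : E4 → ℝ) := hsub j (hP.tsupport_subset hx j)
  have h := hsep i j hij (x i) hi (x j) hj
  rw [hxij, sub_self, norm_zero] at h
  exact absurd h (not_le.2 hr)

/-- **Stub A2 — THE TRUNCATED TIE LIMIT (model-blind analysis; registered signature of the skeleton
`Cruxes/TemperedCurvatureMoments/Lines/Sketch.lean`, verbatim).**  Given the separated density (as a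
hypothesis), lattice densities `D_k` tempered at injective multi-sites of the box for `k ≥ k₀` whose
Riemann sums `(a_k⁴)ⁿ Σₓ (∏ᵢ fᵢ(a_k xᵢ)) D_k x` converge to `T P` on every separated compactly supported
real product tensor `P = ⊗ᵢ fᵢ` have Riemann sums `(a_k⁴)ⁿ Σₓ F(a_k x) D_k x → T F` for every `F ∈ ⁰𝒮`:
equicontinuity on `⁰𝒮` from temperedness (`norm_latticeSum_le`, `norm_mul_weight_le`,
`latticeSum_majorant_le`) and `tendsto_of_mem_closure_span`. [folklore] -/
theorem stub_truncatedTieLimit :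
    ∀ (n : ℕ), 0 < n →
      (∀ F : SchwartzMap (Fin n → E4) ℂ, IsOffDiagonal F →
        F ∈ closure (Submodule.span ℂ {P : SchwartzMap (Fin n → E4) ℂ |
          ∃ f : Fin n → SchwartzMap E4 ℝ, IsTensorOf P (fun i => ofRealTest (f i)) ∧
            ∃ r R : ℝ, 0 < r ∧ (∀ i, tsupport (f i : E4 → ℝ) ⊆ Metric.closedBall (0 : E4) R) ∧
              ∀ i j, i ≠ j → ∀ y ∈ tsupport (f i : E4 → ℝ), ∀ z ∈ tsupport (f j : E4 → ℝ),
                r ≤ ‖y - z‖} : Set (SchwartzMap (Fin n → E4) ℂ))) →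
      ∀ (T : SchwartzMap (Fin n → E4) ℂ →L[ℂ] ℂ) (a : ℕ → ℝ) (L : ℕ → ℕ)
        (D : ℕ → (Fin n → Site 4) → ℝ) (C : ℝ) (N k₀ : ℕ),
        (∀ k, 0 < a k) → Tendsto a atTop (𝓝 0) → Tendsto (fun k => a k * L k) atTop atTop →
        (∀ k, k₀ ≤ k → ∀ x : Fin n → Site 4, (∀ i, x i ∈ box 4 (L k)) → Function.Injective x →
          |D k x| ≤ C * (1 + ‖fun i => a k • siteToE (x i)‖) ^ N *
            (1 + ∑ i, ∑ j ∈ Finset.univ.erase i, ‖a k • siteToE (x i) - a k • siteToE (x j)‖⁻¹) ^ N) →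
        (∀ (f : Fin n → SchwartzMap E4 ℝ) (P : SchwartzMap (Fin n → E4) ℂ),
          IsTensorOf P (fun i => ofRealTest (f i)) →
          (∃ r R : ℝ, 0 < r ∧ (∀ i, tsupport (f i : E4 → ℝ) ⊆ Metric.closedBall (0 : E4) R) ∧
            ∀ i j, i ≠ j → ∀ y ∈ tsupport (f i : E4 → ℝ), ∀ z ∈ tsupport (f j : E4 → ℝ), r ≤ ‖y - z‖) →
          Tendsto (fun k => (((a k ^ 4) ^ n *
            ∑ x ∈ Fintype.piFinset (fun _ : Fin n => box 4 (L k)),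
              (∏ i, f i (a k • siteToE (x i))) * D k x : ℝ) : ℂ)) atTop (𝓝 (T P))) →
        ∀ F : SchwartzMap (Fin n → E4) ℂ, IsOffDiagonal F →
          Tendsto (fun k => (((a k ^ 4) ^ n : ℝ) : ℂ) *
            ∑ x ∈ Fintype.piFinset (fun _ : Fin n => box 4 (L k)),
              F (fun i => a k • siteToE (x i)) * (D k x : ℂ)) atTop (𝓝 (T F)) := by
  intro n hn hdense T a L D C N k₀ ha ha0 _haL hD htie F hF
  have _ := hn
  -- the decay exponent `M = 8n > 4n = dim` and the constants
  set M : ℕ := 8 * n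
  set q : Seminorm ℂ 𝓢((Fin n → E4), ℂ) :=
    (Finset.Iic (N + M, N + 1)).sup (schwartzSeminormFamily ℂ (Fin n → E4) ℂ)
  set K₀ : ℝ := |C| * 4 ^ (N + M) * (1 + (n : ℝ) ^ 2) ^ N
  -- the tempered pair weight, literally the right-hand side of the temperedness hypothesis
  set w : (Fin n → E4) → ℝ := fun y =>
    C * (1 + ‖y‖) ^ N * (1 + ∑ i, ∑ j ∈ Finset.univ.erase i, ‖y i - y j‖⁻¹) ^ N with hw
  have hwC : ∀ y ∉ coincidenceLocus n E4,
      w y ≤ C * (1 + ‖y‖) ^ N * (1 + ∑ i, ∑ j ∈ Finset.univ.erase i, ‖y i - y j‖⁻¹) ^ N :=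
    fun y _ => le_rfl
  have hDw : ∀ k, k₀ ≤ k → ∀ x : Fin n → Site 4, (∀ i, x i ∈ box 4 (L k)) → Function.Injective x →
      |D k x| ≤ w (fun i => a k • siteToE (x i)) := fun k hk x hx hinj => hD k hk x hx hinj
  -- (1) pointwise majorant `‖G y‖ w y ≤ K₀ q(G) (1 + ‖y‖)^{-M}` for `G ∈ ⁰𝒮`
  have hB : ∀ G : 𝓢((Fin n → E4), ℂ), IsOffDiagonal G → ∀ y,
      ‖G y‖ * w y ≤ K₀ * q G * ((1 + ‖y‖) ^ M)⁻¹ := fun G hG y =>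
    DominatedTieLimit.norm_mul_weight_le hG hwC M y
  -- the lattice functionals `Λ_k G = (a_k⁴)ⁿ Σ_{x ∈ boxⁿ} G(a_k x) D_k x`
  set ev : (Fin n → E4) → 𝓢((Fin n → E4), ℂ) →L[ℂ] ℂ := fun y =>
    (BoundedContinuousFunction.evalCLM ℂ y).comp
      (SchwartzMap.toBoundedContinuousFunctionCLM ℂ (Fin n → E4) ℂ) with hev
  set Λ : ℕ → 𝓢((Fin n → E4), ℂ) →L[ℂ] ℂ := fun k =>
    (((a k ^ 4) ^ n : ℝ) : ℂ) • ∑ x ∈ Fintype.piFinset (fun _ : Fin n => box 4 (L k)),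
      (D k x : ℂ) • ev (fun i => a k • siteToE (x i)) with hΛ
  have hΛapply : ∀ k G, Λ k G = (((a k ^ 4) ^ n : ℝ) : ℂ) *
      ∑ x ∈ Fintype.piFinset (fun _ : Fin n => box 4 (L k)),
        G (fun i => a k • siteToE (x i)) * (D k x : ℂ) := by
    intro k G
    simp only [hΛ, hev, smul_apply, FunLike.coe_sum, Finset.sum_apply,
      ContinuousLinearMap.comp_apply, BoundedContinuousFunction.evalCLM_apply, smul_eq_mul]
    congr 1
    exact Finset.sum_congr rfl fun x _ => mul_comm _ _
  -- (2) `‖Λ_k G‖ ≤ (a_k⁴)ⁿ Σ ‖G(a_k x)‖ w(a_k x)` for `k ≥ k₀`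
  have hΛle : ∀ G : 𝓢((Fin n → E4), ℂ), IsOffDiagonal G → ∀ k, k₀ ≤ k →
      ‖Λ k G‖ ≤ (a k ^ 4) ^ n * ∑ x ∈ Fintype.piFinset (fun _ : Fin n => box 4 (L k)),
        ‖G (fun i => a k • siteToE (x i))‖ * w (fun i => a k • siteToE (x i)) := by
    intro G hG k hk
    have hak : 0 ≤ (a k ^ 4) ^ n := by have := ha k; positivity
    rw [hΛapply, norm_mul, Complex.norm_real, Real.norm_of_nonneg hak]
    exact mul_le_mul_of_nonneg_left
      (DominatedTieLimit.norm_latticeSum_le G hG (a k) (L k) (D k) w (hDw k hk)) hak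
  -- equicontinuity on `⁰𝒮`: `‖Λ_k G‖ ≤ K₀ 4^{4n} q(G)` eventually
  have hequi : ∀ G : 𝓢((Fin n → E4), ℂ), IsOffDiagonal G → ∀ᶠ k in atTop,
      ‖Λ k G‖ ≤ K₀ * 4 ^ (4 * n) * q G := by
    intro G hG
    filter_upwards [eventually_ge_atTop k₀, ha0.eventually (eventually_le_nhds zero_lt_one)]
      with k hk hk1
    refine (hΛle G hG k hk).trans ?_
    have h := DominatedTieLimit.latticeSum_majorant_le (ha k) hk1 (L k) (K := K₀ * q G)
      (by positivity) (fun y => ‖G y‖ * w y) (hB G hG)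
    exact h.trans_eq (by ring)
  -- (3) the generators: separated compactly supported real product tensors, on which `Λ_k → T`
  set gens : Set 𝓢((Fin n → E4), ℂ) := {P : SchwartzMap (Fin n → E4) ℂ |
    ∃ f : Fin n → SchwartzMap E4 ℝ, IsTensorOf P (fun i => ofRealTest (f i)) ∧
      ∃ r R : ℝ, 0 < r ∧ (∀ i, tsupport (f i : E4 → ℝ) ⊆ Metric.closedBall (0 : E4) R) ∧
        ∀ i j, i ≠ j → ∀ y ∈ tsupport (f i : E4 → ℝ), ∀ z ∈ tsupport (f j : E4 → ℝ),
          r ≤ ‖y - z‖} with hgens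
  have hgen : ∀ G ∈ gens, Tendsto (fun k => Λ k G) atTop (𝓝 (T G)) := by
    rintro G ⟨f, hP, hsep⟩
    refine (htie f G hP hsep).congr fun k => ?_
    rw [hΛapply]
    push_cast
    refine congrArg _ (Finset.sum_congr rfl fun x _ => ?_)
    rw [hP]
    simp only [ofRealTest_apply]
  have hspanP : ∀ G ∈ Submodule.span ℂ gens, IsOffDiagonal G := by
    intro G hG
    induction hG using Submodule.span_induction with
    | mem G hG =>
      obtain ⟨f, hP, r, R, hr, -, hsep⟩ := hG
      exact isOffDiagonal_of_isTensorOf_separated hP hr hsep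
    | zero => exact isOffDiagonal_zero
    | add G H _ _ hG hH => exact hG.add hH
    | smul c G _ hG => exact hG.smul c
  have hPsub : ∀ G H : 𝓢((Fin n → E4), ℂ), IsOffDiagonal G → IsOffDiagonal H →
      IsOffDiagonal (G - H) := by
    intro G H hG hH
    have h := hG.add (hH.smul (-1))
    rwa [neg_one_smul, ← sub_eq_add_neg] at h
  have hFmem : F ∈ closure (Submodule.span ℂ gens : Set 𝓢((Fin n → E4), ℂ)) := hdense F hF
  -- `Λ_k F → T F`
  have hconv : Tendsto (fun k => Λ k F) atTop (𝓝 (T F)) :=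
    DominatedTieLimit.tendsto_of_mem_closure_span T Λ IsOffDiagonal hPsub (N + M, N + 1)
      (by positivity : (0 : ℝ) ≤ K₀ * 4 ^ (4 * n)) hequi gens hspanP hgen hF hFmem
  simpa only [hΛapply] using hconv

end Summit.QuantumFields.YangMills.Theorems.TemperedCurvatureMoments.Sketch

end
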